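import Literature.NumberTheory.Sieve.SieveFramework
import Mathlib.RingTheory.Radical.NatInt
import HarnessLib

/-!
# A lower bound for Selberg's sum `G(√D)` by partial sums of a multiplicative function

Topic `Literature/NumberTheory/Sieve`. Everything in this file is PROVED.

In Selberg's `Λ²` upper-bound sieve `S(𝒜, P) ≤ X/G(√D) + R` (tree:
`Literature.NumberTheory.Sieve.SelbergSieve.siftedSum_le_totalMass_div_selbergSum_add`, proved in
`SieveFrameworkProofs.lean`) the denominator is `G(√D) = ∑_{l ∣ P, l² ≤ D} g(l)` with Heath-Brown's
multiplicative `g(l) = ∏_{p ∣ l} ν(p)/(1 − ν(p))` (Mathlib `BoundingSieve.selbergTerms`). The classical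
way to bound `G` from below (Halberstam–Richert, *Sieve Methods*, Ch. 3, (1.10)–(1.13) for the
primes: `G(z) ≥ ∑_{n < z} 1/n`; in general van Lint–Richert 1965) is to expand each factor
`ν(p)/(1 − ν(p)) = ∑_{k ≥ 1} (…)` and recognise the partial sums of a non-negative multiplicative
function. This file proves that device in the following finite form:

* `sum_le_sum_squarefree_prod_of_multiplicative` — if `f ≥ 0` is multiplicative and
  `∑_{k=1}^{K} f(p^k) ≤ h(p)` for every prime `p ≤ w`, where `w < 2^{K+1}`, then
  `∑_{n ≤ w} f(n) ≤ ∑_{l ≤ w, l squarefree} ∏_{p ∣ l} h(p)`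
  (group `n ≤ w` by its radical `l`; the `n` with radical `l` inject into the exponent patterns
  `(k_p)_{p ∣ l}`, `1 ≤ k_p ≤ K`, and `f(n) = ∏ f(p^{k_p})`);
* `SelbergSieve.sum_le_selbergSum_of_multiplicative` — consequently, for a Selberg sieve `S` whose
  sifting range contains all primes `p ≤ w`, with `w² ≤ D`, and with
  `∑_{k=1}^{K} f(p^k) ≤ g(p) = ν(p)/(1 − ν(p))` for the primes `p ≤ w`:  `∑_{n ≤ w} f(n) ≤ G(√D)`.

The client is the tree's proof of Motohashi's theorem on the Brun–Titchmarsh constant and Siegel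
zeros (`Literature/Barriers/Parity/BrunTitchmarshSiegelZero.lean`), where `f(n) = (ζ ⋆ χ)(n)/n`.

## References

* H. Halberstam, H.-E. Richert, *Sieve Methods*, Academic Press 1974, Ch. 3 §1 (the sum `G(z)` and
  its lower bound by `∑ 1/n` in the prime case). [cite: HalberstamRichert1974, Ch. 3 §1, Thm. 3.2 and (1.12)]
* D. R. Heath-Brown, *Lectures on sieves* (2002), §2 (the function `g`, Mathlib's `selbergTerms`).
-/

noncomputable section

open Finset
open UniqueFactorizationMonoid (radical)

namespace Literature.NumberTheory.Sieve

/-! ### The radical expansion -/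

/-- For `n ≠ 0` and a prime factor `p` of `n`: `1 ≤ v_p(n)`, and `v_p(n) ≤ K` as soon as
`n < 2^{K+1}`. [folklore] -/
theorem factorization_mem_Icc {n p K : ℕ} (hn : n ≠ 0) (hp : p ∈ n.primeFactors)
    (hK : n < 2 ^ (K + 1)) : n.factorization p ∈ Icc 1 K := by
  have hpp : p.Prime := Nat.prime_of_mem_primeFactors hp
  rw [Finset.mem_Icc]
  refine ⟨hpp.factorization_pos_of_dvd hn (Nat.dvd_of_mem_primeFactors hp), ?_⟩
  have h1 : p ^ n.factorization p ≤ n := Nat.ordProj_le p hn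
  have h2 : 2 ^ (K + 1) ≤ p ^ (K + 1) := Nat.pow_le_pow_left hpp.two_le (K + 1)
  have h3 : p ^ n.factorization p < p ^ (K + 1) := by omega
  have := (Nat.pow_lt_pow_iff_right hpp.one_lt).mp h3
  omega

/-- **The fibre over a radical.** For `f ≥ 0` multiplicative, `l ≠ 0`, and `w < 2^{K+1}`:
`∑_{n ≤ w, rad n = l} f(n) ≤ ∏_{p ∣ l} ∑_{k=1}^{K} f(p^k)`. [folklore] -/
theorem sum_filter_radical_le_prod {f : ArithmeticFunction ℝ} (hf : f.IsMultiplicative)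
    (hf0 : ∀ n, 0 ≤ f n) {w K : ℕ} (hwK : w < 2 ^ (K + 1)) (l : ℕ) :
    ∑ n ∈ (Ioc 0 w).filter (fun n => radical n = l), f n ≤
      ∏ p ∈ l.primeFactors, ∑ k ∈ Icc 1 K, f (p ^ k) := by
  classical
  set fib : Finset ℕ := (Ioc 0 w).filter (fun n => radical n = l) with hfib
  -- exponent patterns `x : l.primeFactors → ℕ`, `1 ≤ x p ≤ K`
  set t : l.primeFactors → Finset ℕ := fun _ => Icc 1 K with ht
  set Φ : (l.primeFactors → ℕ) → ℕ := fun x => ∏ i : l.primeFactors, (i : ℕ) ^ x i with hΦ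
  set ψ : ℕ → (l.primeFactors → ℕ) := fun n i => n.factorization i with hψ
  have hmem : ∀ n ∈ fib, n ≠ 0 ∧ n ≤ w ∧ n.primeFactors = l.primeFactors := by
    intro n hn
    rw [hfib, Finset.mem_filter, Finset.mem_Ioc] at hn
    refine ⟨Nat.pos_iff_ne_zero.mp hn.1.1, hn.1.2, ?_⟩
    rw [← hn.2, Nat.primeFactors_radical]
  -- (a) `ψ` maps the fibre into the patterns
  have hmaps : ∀ n ∈ fib, ψ n ∈ Fintype.piFinset t := by
    intro n hn
    obtain ⟨hn0, hnw, hpf⟩ := hmem n hn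
    rw [Fintype.mem_piFinset]
    intro i
    have hi : (i : ℕ) ∈ n.primeFactors := by rw [hpf]; exact i.2
    exact factorization_mem_Icc hn0 hi (lt_of_le_of_lt hnw hwK)
  -- (b) `ψ` is injective on the fibre
  have hinj : Set.InjOn ψ fib := by
    intro n hn m hm hnm
    obtain ⟨hn0, -, hpfn⟩ := hmem n hn
    obtain ⟨hm0, -, hpfm⟩ := hmem m hm
    refine Nat.eq_of_factorization_eq hn0 hm0 fun p => ?_
    by_cases hp : p ∈ l.primeFactors
    · exact congrFun hnm ⟨p, hp⟩
    · have h1 : n.factorization p = 0 := by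
        rw [← Finsupp.notMem_support_iff, Nat.support_factorization, hpfn]; exact hp
      have h2 : m.factorization p = 0 := by
        rw [← Finsupp.notMem_support_iff, Nat.support_factorization, hpfm]; exact hp
      rw [h1, h2]
  -- (c) `Φ (ψ n) = n` on the fibre
  have hΦψ : ∀ n ∈ fib, Φ (ψ n) = n := by
    intro n hn
    obtain ⟨hn0, -, hpf⟩ := hmem n hn
    simp only [hΦ, hψ]
    rw [Finset.prod_coe_sort l.primeFactors (fun p => p ^ n.factorization p), ← hpf]
    conv_rhs => rw [← Nat.prod_factorization_pow_eq_self hn0]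
    rw [Finsupp.prod, Nat.support_factorization]
  -- (d) `f (Φ x) = ∏ f (p^{x p})`
  have hfΦ : ∀ x : l.primeFactors → ℕ, f (Φ x) = ∏ i : l.primeFactors, f ((i : ℕ) ^ x i) := by
    intro x
    simp only [hΦ]
    refine hf.map_prod (fun i : l.primeFactors => (i : ℕ) ^ x i) Finset.univ ?_
    intro i _ j _ hij
    have hpi : (i : ℕ).Prime := Nat.prime_of_mem_primeFactors i.2
    have hpj : (j : ℕ).Prime := Nat.prime_of_mem_primeFactors j.2
    have hne : (i : ℕ) ≠ j := fun h => hij (Subtype.ext h)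
    exact ((Nat.coprime_primes hpi hpj).mpr hne).pow _ _
  -- assemble
  calc ∑ n ∈ fib, f n = ∑ n ∈ fib, f (Φ (ψ n)) :=
        Finset.sum_congr rfl fun n hn => by rw [hΦψ n hn]
    _ = ∑ x ∈ fib.image ψ, f (Φ x) := (Finset.sum_image (f := fun x => f (Φ x)) hinj).symm
    _ ≤ ∑ x ∈ Fintype.piFinset t, f (Φ x) :=
        Finset.sum_le_sum_of_subset_of_nonneg (Finset.image_subset_iff.mpr hmaps)
          fun x _ _ => hf0 _
    _ = ∑ x ∈ Fintype.piFinset t, ∏ i : l.primeFactors, f ((i : ℕ) ^ x i) :=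
        Finset.sum_congr rfl fun x _ => hfΦ x
    _ = ∏ i : l.primeFactors, ∑ k ∈ Icc 1 K, f ((i : ℕ) ^ k) :=
        (Finset.prod_univ_sum t (fun (i : l.primeFactors) k => f ((i : ℕ) ^ k))).symm
    _ = ∏ p ∈ l.primeFactors, ∑ k ∈ Icc 1 K, f (p ^ k) :=
        Finset.prod_coe_sort l.primeFactors (fun p => ∑ k ∈ Icc 1 K, f (p ^ k))

/-- **Radical expansion** (the device behind `G(z) ≥ ∑_{n<z} 1/n`, Halberstam–Richert Ch. 3 §1):
if `f ≥ 0` is multiplicative, `w < 2^{K+1}`, and `∑_{k=1}^{K} f(p^k) ≤ h(p)` for every prime `p ≤ w`,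
then `∑_{n ≤ w} f(n) ≤ ∑_{l ≤ w, l squarefree} ∏_{p ∣ l} h(p)`.
[cite: HalberstamRichert1974, Ch. 3 §1, (1.12)] -/
theorem sum_le_sum_squarefree_prod_of_multiplicative {f : ArithmeticFunction ℝ}
    (hf : f.IsMultiplicative) (hf0 : ∀ n, 0 ≤ f n) {h : ℕ → ℝ} {w K : ℕ} (hwK : w < 2 ^ (K + 1))
    (hh : ∀ p, p.Prime → p ≤ w → ∑ k ∈ Icc 1 K, f (p ^ k) ≤ h p) :
    ∑ n ∈ Ioc 0 w, f n ≤ ∑ l ∈ (Ioc 0 w).filter Squarefree, ∏ p ∈ l.primeFactors, h p := by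
  classical
  have hmaps : ∀ n ∈ Ioc 0 w, radical n ∈ (Ioc 0 w).filter Squarefree := by
    intro n hn
    rw [Finset.mem_Ioc] at hn
    have hn0 : n ≠ 0 := Nat.pos_iff_ne_zero.mp hn.1
    rw [Finset.mem_filter, Finset.mem_Ioc]
    exact ⟨⟨Nat.radical_pos n, (Nat.radical_le_self_iff.mpr hn0).trans hn.2⟩,
      UniqueFactorizationMonoid.squarefree_radical⟩
  rw [← Finset.sum_fiberwise_of_maps_to hmaps]
  refine Finset.sum_le_sum fun l hl => ?_
  rw [Finset.mem_filter, Finset.mem_Ioc] at hl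
  refine (sum_filter_radical_le_prod hf hf0 hwK l).trans ?_
  refine Finset.prod_le_prod (fun p _ => Finset.sum_nonneg fun k _ => hf0 _) fun p hp => ?_
  exact hh p (Nat.prime_of_mem_primeFactors hp) ((Nat.le_of_mem_primeFactors hp).trans hl.1.2)

/-! ### Application to Selberg's sum -/

/-- For a squarefree `l`, Heath-Brown's `g(l) = ∏_{p ∣ l} g(p)` (multiplicativity of Mathlib's
`BoundingSieve.selbergTerms`). [folklore] -/
theorem selbergTerms_eq_prod (s : BoundingSieve) {l : ℕ} (hl : Squarefree l) :
    s.selbergTerms l = ∏ p ∈ l.primeFactors, s.selbergTerms p :=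
  ((BoundingSieve.selbergTerms_isMultiplicative (s := s)).prod_primeFactors hl).symm

/-- **`G(√D) ≥ ∑_{n ≤ w} f(n)`.** Let `S` be a Selberg sieve whose sifting range `P` contains every
prime `p ≤ w`, with level `D ≥ w²`. If `f ≥ 0` is multiplicative, `w < 2^{K+1}`, and
`∑_{k=1}^{K} f(p^k) ≤ g(p)` (`= ν(p)/(1 − ν(p))`, Mathlib `selbergTerms`) for every prime `p ≤ w`, then
`∑_{n ≤ w} f(n) ≤ G(√D) = S.selbergSum`. [cite: HalberstamRichert1974, Ch. 3 §1, (1.12)] -/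
theorem _root_.SelbergSieve.sum_le_selbergSum_of_multiplicative (S : SelbergSieve)
    {f : ArithmeticFunction ℝ} (hf : f.IsMultiplicative) (hf0 : ∀ n, 0 ≤ f n) {w K : ℕ}
    (hwK : w < 2 ^ (K + 1)) (hD : (w : ℝ) ^ 2 ≤ S.level)
    (hP : ∀ p, p.Prime → p ≤ w → p ∣ S.prodPrimes)
    (hh : ∀ p, p.Prime → p ≤ w → ∑ k ∈ Icc 1 K, f (p ^ k) ≤ S.selbergTerms p) :
    ∑ n ∈ Ioc 0 w, f n ≤ S.selbergSum := by
  classical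
  refine (sum_le_sum_squarefree_prod_of_multiplicative hf hf0 hwK hh).trans ?_
  rw [SelbergSieve.selbergSum]
  -- the squarefree `l ≤ w` are among the `l ∣ P` with `l² ≤ D`, and the terms agree
  have hsub : (Ioc 0 w).filter Squarefree ⊆
      S.prodPrimes.divisors.filter (fun l : ℕ => (l : ℝ) ^ 2 ≤ S.level) := by
    intro l hl
    rw [Finset.mem_filter, Finset.mem_Ioc] at hl
    rw [Finset.mem_filter, Nat.mem_divisors]
    refine ⟨⟨?_, BoundingSieve.prodPrimes_ne_zero⟩, ?_⟩
    · rw [← Nat.prod_primeFactors_of_squarefree hl.2]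
      refine Finset.prod_primes_dvd _ (fun p hp => (Nat.prime_of_mem_primeFactors hp).prime) ?_
      intro p hp
      exact hP p (Nat.prime_of_mem_primeFactors hp) ((Nat.le_of_mem_primeFactors hp).trans hl.1.2)
    · have : (l : ℝ) ≤ w := by exact_mod_cast hl.1.2
      exact le_trans (pow_le_pow_left₀ (Nat.cast_nonneg l) this 2) hD
  calc ∑ l ∈ (Ioc 0 w).filter Squarefree, ∏ p ∈ l.primeFactors, S.selbergTerms p
      = ∑ l ∈ (Ioc 0 w).filter Squarefree, S.selbergTerms l :=
        Finset.sum_congr rfl fun l hl => (selbergTerms_eq_prod S.toBoundingSieve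
          (Finset.mem_filter.mp hl).2).symm
    _ ≤ ∑ l ∈ S.prodPrimes.divisors.filter (fun l : ℕ => (l : ℝ) ^ 2 ≤ S.level),
          S.selbergTerms l :=
        Finset.sum_le_sum_of_subset_of_nonneg hsub fun l hl _ =>
          (BoundingSieve.selbergTerms_pos (Nat.dvd_of_mem_divisors (Finset.mem_filter.mp hl).1)).le

end Literature.NumberTheory.Sieve

end
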